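import Literature.MathematicalPhysics.QuantumFieldTheory.Balaban1983to89.Node00.N24GlueStage8

/-!
# NODE N24 · THE β-WINDOW OF (B2) IS BINDER B3's — `BetaBoundsInInterval` ∕ the box bounds on `D.βfun` FROM the apex's perturbative β-hypothesis
# `FlowStep.BetaPertH D.βfun β̄` with `0 < β̄` (`T4ContinuumYM4Torus.continuumYM4_torus_of_BetaPertH`'s `hP`, `hβbar`; packaged `T4Continuum.BetaPertHyp D.βfun`),
# BY NAME (`FlowStep.betaAFH_of_pert`, `FlowStep.betaUpperH_of_pert`, `FlowStep.box_mono`) — and N24 at a record GIVEN B3: the ten children at a γ-LOWERED record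
# world over the same datum suffice, no separate β-binder

TRACK A (YM-PLAN §2d, node N24 of 28), seat `pub-ymgap-dag-n24-a` (-a KNIT-BY-NAME: «… report which child blocks»).  TWELFTH N24 module, a NEW importing one.  Until now
N24's glue displayed its β-side as two free-standing binders — `FlowStep.BetaLowerH w.b γ₀ D.βfun` (a uniform lower bound `b > 0` on the box `]0, γ₀]^{k+1}`: UNPRINTED as
such, census T09.F) and `FlowStep.BetaUpperH w.βup γ₀ D.βfun` ([Balaban1987RG1] p. 264) — or, in the design-E faces, as `∃ γ₀ b β⁺, 0 < γ₀ ∧ 0 < b ∧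
BetaBoundsInInterval D.C.toB12 γ₀ b β⁺`.  This file records, in the kernel and by name, that BOTH are consequences of the apex's OWN β-binder B3 = NODE O's statement
of record (n25; ROSTER-D0062: «n26∕n28 are bookkeeping shadows of NODE O's β-side»): the perturbative form `BetaPertH β β̄ := ∃ γ₀ > 0, ∃ C ≥ 0, ∀ γ ∈ ]0, γ₀], ∀ k v ∈
Box γ k, |β k v − β̄| ≤ C γ²` with `β̄ > 0` gives, on a smaller box, `β ≥ b := β̄∕2 > 0` (`FlowStep.betaAFH_of_pert`) and `β ≤ β̄ + C γ₀²` (`FlowStep.betaUpperH_of_pert`).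
Consequently N24's «which child blocks» has NO independent β-row: the β-window is N25's (B3 + the side condition `0 < β̄` of B6), and (B2) at a record follows from
the TEN paper children at a γ-lowered record world over the same datum (§3) — the lowering is the printed «for γ sufficiently small» ([Balaban1989LargeFieldII] Thm 1
p. 355), available because every record predicate of the chain is closed under γ-lowering re-lettering (`N24_isRecordOfRecord₅C_reletter`, `N24_isRecordOfRecord₈C_reletter`).
THEOREMS ONLY, def-free, sorry-free, standard axioms; nothing of NODE O's asserted (B3 is displayed as a hypothesis exactly as the apex displays it).

WHAT THIS FILE PROVES.
* §1 (pure `FlowStep`) `N24_betaBox_of_betaPertH` — `0 < β̄ → BetaPertH β β̄ → ∃ γᵦ b β⁺, 0 < γᵦ ∧ 0 < b ∧ BetaLowerH b γᵦ β ∧ BetaUpperH β⁺ γᵦ β`;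
  `N24_betaBox_of_betaPertHyp` — the same from the packaged `T4Continuum.BetaPertHyp β` (whose continuity half is not used).
* §2 (at a datum) `N24_betaBoundsInInterval_of_betaPertH` ∕ `_of_betaPertHyp` — `∃ γ₀ b β⁺, 0 < γ₀ ∧ 0 < b ∧ BetaBoundsInInterval D.C.toB12 γ₀ b β⁺`, i.e. the β-part
  `SβE` ∕ `hβ` of the design-E faces (`N24_at_datumE_of_refines₅C`, `N24_at_datumE_threshold_of_refines₅C`, dagwriter's `RenormalisationBetaE`) IS B3's — through `D.curries`
  and `DagBinding.betaBoundsInInterval_of_boxBounds`; `N24_at_datumE_threshold_of_refines₅C_of_betaPertHyp`, `N24_B2_atRecordE_threshold_of_refines₅C_of_betaPertHyp` — the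
  design-E faces with the β-side READ AS B3 per datum (same VACUITY NOTE at `Rec := ₅C ∕ ₈C` themselves: carriers free; the faces are for the pinning stages).
* §3 (per record — the non-vacuous currency) **`N24_at_record₅C_lowered_of_betaPertH`**: a `₅C` record `(D, w)` and B3 at `D.βfun` give an EXPLICIT γ-lowered
  re-lettering `w'` of `w` (same construction, binding and `L`; `0 < w'.γ ≤ w.γ`; `w'.b`, `w'.βup` := the B3 bounds) which is again a `₅C` record over `D` and at which
  the ten children N03, N05–N13 ALONE imply `B16.EndStatementBPrinted D.C`; `…₈C…` twin (Stage 8: there B3 is a statement about the β OF RECORD `betaOfRecord₈ θ` — the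
  Summits-side `BalabanUVNodesN28AtBetaOfRecord.betaPertH_betaOfMerged_iff` reads it on the merged β); `N24_at_record₅C_of_betaPertH_smallWorld` — if the record world is
  ALREADY below B3's threshold (`w.γ ≤ γᵦ`), the children AT `w` itself suffice (re-letter only `b`, `β⁺`, which no child reads … EXCEPT through `leavesP`'s β-leaves —
  hence stated at the re-lettered world, letters displayed).
WHICH CHILD BLOCKS after this file: THEOREMS — N01 N02 N04 N23, `hC`, `hγ`, guarded (0.20), AND the β-window GIVEN B3; BY NAME MODULO SLOTS — N03, N08, N10, N11, N13 (𝐑 :=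
the world's leaf); PURE BINDERS — N05 N06 N07 N09 N12; UPSTREAM BINDER — B3 `0 < β̄ ∧ BetaPertH D.βfun β̄` (NODE O = n25; at ₈ a statement about the merged β of record).
ETA(N24) = max(N13, N25, carrier-pinning stages).
HONEST FRAMING: kernel bookkeeping BY NAME; B3 is DISPLAYED, not asserted (it is NODE O's open estimate — asymptotic freedom with the perturbative remainder, [Balaban1987RG1]
(1.22) p. 264 + (2.12)–(2.14) p. 268, UNPRINTED as a uniform statement: census T09.F); N24 COMPOSITE — no discharge, no count; one finite T⁴ programme at fixed ε; NOT
continuum ∕ ℝ⁴ ∕ OS ∕ mass gap ∕ Clay.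
-/

noncomputable section

namespace Literature.MathematicalPhysics.QuantumFieldTheory.Balaban1983to89.Node00

open DagBinding T4Continuum T4DatumAssembly FlowStep

/-! ## §1. Box bounds from the perturbative form (pure `FlowStep`) -/

/-- **B3 ⇒ N24's two β-binders on a common box**: from `0 < β̄` and `BetaPertH β β̄` there are `γᵦ > 0`, `b > 0` and `β⁺` with `b ≤ β ≤ β⁺` on every box `]0, γᵦ]^{k+1}`
(`FlowStep.betaAFH_of_pert` for the lower half, `FlowStep.betaUpperH_of_pert` for the upper, `FlowStep.box_mono` to the smaller radius).
[cite: Balaban1987RG1, (1.22) p.264 and (2.12)–(2.14) p.268 (the perturbative form; folklore consequence)] -/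
theorem N24_betaBox_of_betaPertH {β : HBeta} {βbar : ℝ} (hbar : 0 < βbar) (hP : BetaPertH β βbar) :
    ∃ γβ b βup : ℝ, 0 < γβ ∧ 0 < b ∧ BetaLowerH b γβ β ∧ BetaUpperH βup γβ β := by
  obtain ⟨γ₁, hγ₁, b, hb, hlo⟩ := betaAFH_of_pert hbar hP
  obtain ⟨γ₂, hγ₂, βup, hup⟩ := betaUpperH_of_pert hP
  exact ⟨min γ₁ γ₂, b, βup, lt_min hγ₁ hγ₂, hb, fun k v hv => hlo k v (box_mono (min_le_left _ _) k hv),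
    fun k v hv => hup k v (box_mono (min_le_right _ _) k hv)⟩

/-- The same from the PACKAGED β-hypothesis of the apex `T4Continuum.BetaPertHyp β = (∃ β̄ > 0, BetaPertH β β̄) ∧ (∃ γc > 0, BetaContH γc β)` (its continuity half — binder B4 —
is not used). [cite: Balaban1987RG1, (1.22) p.264 (folklore consequence)] -/
theorem N24_betaBox_of_betaPertHyp {β : HBeta} (h : BetaPertHyp β) :
    ∃ γβ b βup : ℝ, 0 < γβ ∧ 0 < b ∧ BetaLowerH b γβ β ∧ BetaUpperH βup γβ β := by
  obtain ⟨⟨βbar, hbar, hP⟩, -⟩ := h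
  exact N24_betaBox_of_betaPertH hbar hP

/-! ## §2. At a datum: the β-part of the design-E faces is B3's -/

variable {F : T4Family} {N : ℕ} [NeZero N]

/-- **B3 ⇒ `BetaBoundsInInterval` for the datum's construction**: `0 < β̄`, `BetaPertH D.βfun β̄` give `∃ γ₀ b β⁺, 0 < γ₀ ∧ 0 < b ∧ BetaBoundsInInterval D.C.toB12 γ₀ b β⁺` —
the `SβE` ∕ `hβ` input of the design-E faces — through the datum's currying clause `D.curries` (`DagBinding.betaBoundsInInterval_of_boxBounds`).
[cite: Balaban1987RG1, (1.22) p.264; Balaban1989LargeFieldII, Thm 1 p.355 (bookkeeping)] -/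
theorem N24_betaBoundsInInterval_of_betaPertH (D : FiniteEpsData F (SU N)) {βbar : ℝ} (hbar : 0 < βbar) (hP : BetaPertH D.βfun βbar) :
    ∃ γ₀ b βup : ℝ, 0 < γ₀ ∧ 0 < b ∧ BetaBoundsInInterval D.C.toB12 γ₀ b βup := by
  obtain ⟨γβ, b, βup, hγβ, hb, hlo, hhi⟩ := N24_betaBox_of_betaPertH hbar hP
  exact ⟨γβ, b, βup, hγβ, hb, DagBinding.betaBoundsInInterval_of_boxBounds D.C.toB12 D.βfun D.curries hlo hhi⟩

/-- The same from the packaged `BetaPertHyp D.βfun`. [cite: Balaban1987RG1, (1.22) p.264 (bookkeeping)] -/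
theorem N24_betaBoundsInInterval_of_betaPertHyp (D : FiniteEpsData F (SU N)) (h : BetaPertHyp D.βfun) :
    ∃ γ₀ b βup : ℝ, 0 < γ₀ ∧ 0 < b ∧ BetaBoundsInInterval D.C.toB12 γ₀ b βup := by
  obtain ⟨⟨βbar, hbar, hP⟩, -⟩ := h
  exact N24_betaBoundsInInterval_of_betaPertH D hbar hP

section DesignE

variable {Rec : FiniteEpsData F (SU N) → WorldP → Prop}

/-- **Design E with thresholds, β-side READ AS B3** (module 7's `N24_at_datumE_threshold_of_refines₅C` with `hβ := N24_betaBoundsInInterval_of_betaPertHyp D hB3`): over any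
record predicate refining `₅C` and closed under γ-lowering re-lettering, a `Rec`-world over `D`, the nine children below one threshold, N13 in the threshold text, and
`BetaPertHyp D.βfun` give `B16.EndStatementBPrinted D.C`.  VACUITY NOTE as in modules 5 ∕ 7 ∕ 10 (not for `Rec := ₅C ∕ ₈C` themselves while the carriers are free).
[cite: Balaban1989LargeFieldII, Thm 1 p.355 + p.391; Balaban1988Convergent, Cor. 3 (2.50) p.264; Balaban1987RG1, Thm 1 p.259 and (1.22) p.264 (bookkeeping)] -/
theorem N24_at_datumE_threshold_of_refines₅C_of_betaPertHyp
    (hRec : ∀ {D : FiniteEpsData F (SU N)} {w : WorldP}, Rec D w → IsRecordOfRecord₅C F N D w)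
    (hRL : ∀ {D : FiniteEpsData F (SU N)} {w : WorldP} {γ' b' : ℝ} (hγ' : 0 < γ') (_ : γ' ≤ w.γ) (hb' : 0 < b') (βup' : ℝ) (em ep : ℝ → ℝ),
      Rec D w → Rec D { w with γ := γ', b := b', b_pos := hb', βup := βup', em := em, ep := ep })
    {D : FiniteEpsData F (SU N)} (hex : ∃ w : WorldP, Rec D w) {γs : ℝ} (hγs : 0 < γs)
    (h03 : ∀ w : WorldP, Rec D w → w.γ ≤ γs → ∀ P : B12.RunParams, Dag.B6_main (leavesP w P))
    (h05 : ∀ w : WorldP, Rec D w → w.γ ≤ γs → ∀ P : B12.RunParams, Dag.B8_main (leavesP w P))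
    (h06 : ∀ w : WorldP, Rec D w → w.γ ≤ γs → ∀ P : B12.RunParams, Dag.B9_main (leavesP w P))
    (h07 : ∀ w : WorldP, Rec D w → w.γ ≤ γs → ∀ P : B12.RunParams, Dag.B11_main (leavesP w P))
    (h08 : ∀ w : WorldP, Rec D w → w.γ ≤ γs → ∀ P : B12.RunParams, Dag.B10_main (leavesP w P))
    (h09 : ∀ w : WorldP, Rec D w → w.γ ≤ γs → ∀ P : B12.RunParams, Dag.B12_main (leavesP w P))
    (h10 : ∀ w : WorldP, Rec D w → w.γ ≤ γs → ∀ P : B12.RunParams, Dag.B13_main (leavesP w P))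
    (h11 : ∀ w : WorldP, Rec D w → w.γ ≤ γs → ∀ P : B12.RunParams, Dag.B14_main (leavesP w P))
    (h12 : ∀ w : WorldP, Rec D w → w.γ ≤ γs → ∀ P : B12.RunParams, Dag.B15_main (leavesP w P))
    (h13 : ∃ γ₁ : ℝ, 0 < γ₁ ∧ ∃ em ep : ℝ → ℝ, ∀ w : WorldP, Rec D w → w.γ ≤ γ₁ → w.em = em → w.ep = ep →
      ∀ P : B12.RunParams, Dag.B16_main (leavesP w P))
    (hB3 : BetaPertHyp D.βfun) : B16.EndStatementBPrinted D.C :=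
  N24_at_datumE_threshold_of_refines₅C hRec hRL hex hγs h03 h05 h06 h07 h08 h09 h10 h11 h12 h13
    (N24_betaBoundsInInterval_of_betaPertHyp D hB3)

/-- **Cluster level, β-side READ AS B3 per record datum** (module 7's `N24_B2_atRecordE_threshold_of_refines₅C` with `SβE := fun D _ _ => N24_betaBoundsInInterval_of_betaPertHyp D …`):
the apex's own β-binder at every datum carrying a `Rec`-world replaces the `RenormalisationBetaE` β-part. [cite: Balaban1989LargeFieldII, Thm 1 p.355 + p.391; Balaban1987RG1, Thm 1 p.259 and (1.22) p.264 (bookkeeping)] -/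
theorem N24_B2_atRecordE_threshold_of_refines₅C_of_betaPertHyp
    (hRec : ∀ {D : FiniteEpsData F (SU N)} {w : WorldP}, Rec D w → IsRecordOfRecord₅C F N D w)
    (hRL : ∀ {D : FiniteEpsData F (SU N)} {w : WorldP} {γ' b' : ℝ} (hγ' : 0 < γ') (_ : γ' ≤ w.γ) (hb' : 0 < b') (βup' : ℝ) (em ep : ℝ → ℝ),
      Rec D w → Rec D { w with γ := γ', b := b', b_pos := hb', βup := βup', em := em, ep := ep })
    (SK : ∀ D : FiniteEpsData F (SU N), (∃ w : WorldP, Rec D w) → ∃ γs : ℝ, 0 < γs ∧ ∀ w : WorldP, Rec D w → w.γ ≤ γs →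
      ∀ P : B12.RunParams, Dag.B6_main (leavesP w P) ∧ Dag.B8_main (leavesP w P) ∧ Dag.B9_main (leavesP w P) ∧ Dag.B11_main (leavesP w P) ∧
        Dag.B10_main (leavesP w P) ∧ Dag.B12_main (leavesP w P) ∧ Dag.B13_main (leavesP w P) ∧ Dag.B14_main (leavesP w P) ∧
        Dag.B15_main (leavesP w P))
    (S13 : ∀ D : FiniteEpsData F (SU N), (∃ w : WorldP, Rec D w) →
      ∃ γ₁ : ℝ, 0 < γ₁ ∧ ∃ em ep : ℝ → ℝ, ∀ w : WorldP, Rec D w → w.γ ≤ γ₁ → w.em = em → w.ep = ep →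
        ∀ P : B12.RunParams, Dag.B16_main (leavesP w P))
    (SB3 : ∀ (D : FiniteEpsData F (SU N)) (w : WorldP), Rec D w → BetaPertHyp D.βfun) :
    ∀ (D : FiniteEpsData F (SU N)) (w : WorldP), Rec D w → B16.EndStatementBPrinted D.C :=
  N24_B2_atRecordE_threshold_of_refines₅C hRec hRL SK S13 fun D w hw => N24_betaBoundsInInterval_of_betaPertHyp D (SB3 D w hw)

end DesignE

/-! ## §3. Per record: GIVEN B3, the ten children at a γ-lowered record world over the same datum suffice -/

section PerRecord

variable {D : FiniteEpsData F (SU N)} {w : WorldP}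

/-- **N24 at a `₅C` record GIVEN B3 — the children at a γ-LOWERED record world suffice, no separate β-binder.**  From a `₅C` record `(D, w)` and B3 at the datum's
β-functions (`0 < β̄`, `BetaPertH D.βfun β̄`): there is an explicit re-lettering `w'` of `w` — SAME construction `w'.C = w.C`, SAME binding `w'.up = w.up`, SAME `L`,
exponent letters unchanged, `γ` lowered to `min w.γ γᵦ` (so `0 < w'.γ ≤ w.γ`), `(b, β⁺)` := B3's box bounds — which is again a `₅C` record over `D`
(`N24_isRecordOfRecord₅C_reletter`) and at which the TEN children N03, N05–N13 imply `B16.EndStatementBPrinted D.C` (`N24_at_record₅C'` with the B3 bounds on `]0, w'.γ]`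
by `box_mono`).  The lowering is [Balaban1989LargeFieldII] Thm 1's «γ sufficiently small». [cite: Balaban1989LargeFieldII, Thm 1 p.355 + p.391; Balaban1987RG1, (1.22) p.264; Balaban1988Convergent, Cor. 3 (2.50) p.264 (bookkeeping)] -/
theorem N24_at_record₅C_lowered_of_betaPertH (h : IsRecordOfRecord₅C F N D w) {βbar : ℝ} (hbar : 0 < βbar) (hP : BetaPertH D.βfun βbar) :
    ∃ w' : WorldP, IsRecordOfRecord₅C F N D w' ∧ w'.C = w.C ∧ w'.up = w.up ∧ w'.L = w.L ∧ w'.em = w.em ∧ w'.ep = w.ep ∧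
      0 < w'.γ ∧ w'.γ ≤ w.γ ∧
      ((∀ P : B12.RunParams, Dag.B6_main (leavesP w' P)) → (∀ P : B12.RunParams, Dag.B8_main (leavesP w' P)) →
        (∀ P : B12.RunParams, Dag.B9_main (leavesP w' P)) → (∀ P : B12.RunParams, Dag.B11_main (leavesP w' P)) →
        (∀ P : B12.RunParams, Dag.B10_main (leavesP w' P)) → (∀ P : B12.RunParams, Dag.B12_main (leavesP w' P)) →
        (∀ P : B12.RunParams, Dag.B13_main (leavesP w' P)) → (∀ P : B12.RunParams, Dag.B14_main (leavesP w' P)) →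
        (∀ P : B12.RunParams, Dag.B15_main (leavesP w' P)) → (∀ P : B12.RunParams, Dag.B16_main (leavesP w' P)) →
        B16.EndStatementBPrinted D.C) := by
  obtain ⟨γβ, b, βup, hγβ, hb, hlo, hhi⟩ := N24_betaBox_of_betaPertH hbar hP
  have hwγ : 0 < w.γ := gamma_pos_of_isRecordOfRecord₅C h
  have hγ' : 0 < min w.γ γβ := lt_min hwγ hγβ
  have h' : IsRecordOfRecord₅C F N D { w with γ := min w.γ γβ, b := b, b_pos := hb, βup := βup, em := w.em, ep := w.ep } :=
    N24_isRecordOfRecord₅C_reletter h hγ' hb βup w.em w.ep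
  refine ⟨{ w with γ := min w.γ γβ, b := b, b_pos := hb, βup := βup, em := w.em, ep := w.ep }, h', rfl, rfl, rfl, rfl, rfl, hγ',
    min_le_left _ _, fun h03 h05 h06 h07 h08 h09 h10 h11 h12 h13 => ?_⟩
  exact N24_at_record₅C' h' h03 h05 h06 h07 h08 h09 h10 h11 h12 h13 (fun k v hv => hlo k v (box_mono (min_le_right _ _) k hv))
    fun k v hv => hhi k v (box_mono (min_le_right _ _) k hv)

/-- The same from the packaged `BetaPertHyp D.βfun` (the apex's β-binder verbatim). [cite: Balaban1989LargeFieldII, Thm 1 p.355 + p.391; Balaban1987RG1, (1.22) p.264 (bookkeeping)] -/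
theorem N24_at_record₅C_lowered_of_betaPertHyp (h : IsRecordOfRecord₅C F N D w) (hB3 : BetaPertHyp D.βfun) :
    ∃ w' : WorldP, IsRecordOfRecord₅C F N D w' ∧ w'.C = w.C ∧ w'.up = w.up ∧ w'.L = w.L ∧ w'.em = w.em ∧ w'.ep = w.ep ∧
      0 < w'.γ ∧ w'.γ ≤ w.γ ∧
      ((∀ P : B12.RunParams, Dag.B6_main (leavesP w' P)) → (∀ P : B12.RunParams, Dag.B8_main (leavesP w' P)) →
        (∀ P : B12.RunParams, Dag.B9_main (leavesP w' P)) → (∀ P : B12.RunParams, Dag.B11_main (leavesP w' P)) →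
        (∀ P : B12.RunParams, Dag.B10_main (leavesP w' P)) → (∀ P : B12.RunParams, Dag.B12_main (leavesP w' P)) →
        (∀ P : B12.RunParams, Dag.B13_main (leavesP w' P)) → (∀ P : B12.RunParams, Dag.B14_main (leavesP w' P)) →
        (∀ P : B12.RunParams, Dag.B15_main (leavesP w' P)) → (∀ P : B12.RunParams, Dag.B16_main (leavesP w' P)) →
        B16.EndStatementBPrinted D.C) := by
  obtain ⟨⟨βbar, hbar, hP⟩, -⟩ := hB3
  exact N24_at_record₅C_lowered_of_betaPertH h hbar hP

/-- **N24 at a `₅C` record ALREADY BELOW B3's THRESHOLD**: if B3's box bounds hold on `]0, γᵦ]` with `w.γ ≤ γᵦ` — displayed as the two bounds on the world's own box,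
which B3 supplies for small worlds (§1) — then the ten children at the world re-lettered ONLY in `(b, β⁺)` imply (B2).  (The letters `b`, `β⁺` enter `leavesP` through the
β-leaves `betaPositive` ∕ `betaSmoothBounded`, so the children are displayed at the re-lettered world, not at `w`.) [cite: Balaban1989LargeFieldII, Thm 1 p.355 + p.391; Balaban1987RG1, (1.22) p.264 (bookkeeping)] -/
theorem N24_at_record₅C_reletterB_of_boxBounds (h : IsRecordOfRecord₅C F N D w) {b βup : ℝ} (hb : 0 < b)
    (hlo : BetaLowerH b w.γ D.βfun) (hhi : BetaUpperH βup w.γ D.βfun)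
    (h03 : ∀ P : B12.RunParams, Dag.B6_main (leavesP { w with b := b, b_pos := hb, βup := βup } P))
    (h05 : ∀ P : B12.RunParams, Dag.B8_main (leavesP { w with b := b, b_pos := hb, βup := βup } P))
    (h06 : ∀ P : B12.RunParams, Dag.B9_main (leavesP { w with b := b, b_pos := hb, βup := βup } P))
    (h07 : ∀ P : B12.RunParams, Dag.B11_main (leavesP { w with b := b, b_pos := hb, βup := βup } P))
    (h08 : ∀ P : B12.RunParams, Dag.B10_main (leavesP { w with b := b, b_pos := hb, βup := βup } P))
    (h09 : ∀ P : B12.RunParams, Dag.B12_main (leavesP { w with b := b, b_pos := hb, βup := βup } P))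
    (h10 : ∀ P : B12.RunParams, Dag.B13_main (leavesP { w with b := b, b_pos := hb, βup := βup } P))
    (h11 : ∀ P : B12.RunParams, Dag.B14_main (leavesP { w with b := b, b_pos := hb, βup := βup } P))
    (h12 : ∀ P : B12.RunParams, Dag.B15_main (leavesP { w with b := b, b_pos := hb, βup := βup } P))
    (h13 : ∀ P : B12.RunParams, Dag.B16_main (leavesP { w with b := b, b_pos := hb, βup := βup } P)) :
    B16.EndStatementBPrinted D.C :=
  have h' : IsRecordOfRecord₅C F N D { w with γ := w.γ, b := b, b_pos := hb, βup := βup, em := w.em, ep := w.ep } :=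
    N24_isRecordOfRecord₅C_reletter h (gamma_pos_of_isRecordOfRecord₅C h) hb βup w.em w.ep
  N24_at_record₅C' h' h03 h05 h06 h07 h08 h09 h10 h11 h12 h13 hlo hhi

/-- **The Stage-8 twin**: a `₈C` record `(D, w)` and B3 at `D.βfun` (`= betaOfRecord₈ θ`, `βfun_stage8` — at Stage 8 B3 IS a statement about the β of record; its
merged-β reading is `BalabanUVNodesN28AtBetaOfRecord.betaPertH_betaOfMerged_iff`, Summits-side) give a γ-lowered `₈C` record world over `D` at which the ten children
imply (B2) — `N24_isRecordOfRecord₈C_reletter` keeps `₈C` (the lowered `γ` stays inside `]0, θ.γ]`). [cite: Balaban1989LargeFieldII, Thm 1 p.355 + p.391; Balaban1987RG1, (1.20)–(1.22) p.264 (bookkeeping over the Stage-8 record)] -/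
theorem N24_at_record₈C_lowered_of_betaPertH (h : IsRecordOfRecord₈C F N D w) {βbar : ℝ} (hbar : 0 < βbar) (hP : BetaPertH D.βfun βbar) :
    ∃ w' : WorldP, IsRecordOfRecord₈C F N D w' ∧ w'.C = w.C ∧ w'.up = w.up ∧ w'.L = w.L ∧ w'.em = w.em ∧ w'.ep = w.ep ∧
      0 < w'.γ ∧ w'.γ ≤ w.γ ∧
      ((∀ P : B12.RunParams, Dag.B6_main (leavesP w' P)) → (∀ P : B12.RunParams, Dag.B8_main (leavesP w' P)) →
        (∀ P : B12.RunParams, Dag.B9_main (leavesP w' P)) → (∀ P : B12.RunParams, Dag.B11_main (leavesP w' P)) →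
        (∀ P : B12.RunParams, Dag.B10_main (leavesP w' P)) → (∀ P : B12.RunParams, Dag.B12_main (leavesP w' P)) →
        (∀ P : B12.RunParams, Dag.B13_main (leavesP w' P)) → (∀ P : B12.RunParams, Dag.B14_main (leavesP w' P)) →
        (∀ P : B12.RunParams, Dag.B15_main (leavesP w' P)) → (∀ P : B12.RunParams, Dag.B16_main (leavesP w' P)) →
        B16.EndStatementBPrinted D.C) := by
  obtain ⟨γβ, b, βup, hγβ, hb, hlo, hhi⟩ := N24_betaBox_of_betaPertH hbar hP
  have hwγ : 0 < w.γ := gamma_pos_of_isRecordOfRecord₅C (isRecordOfRecord₅C_of_isRecordOfRecord₈C h)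
  have hγ' : 0 < min w.γ γβ := lt_min hwγ hγβ
  have h' : IsRecordOfRecord₈C F N D { w with γ := min w.γ γβ, b := b, b_pos := hb, βup := βup, em := w.em, ep := w.ep } :=
    N24_isRecordOfRecord₈C_reletter h hγ' (min_le_left _ _) hb βup w.em w.ep
  refine ⟨{ w with γ := min w.γ γβ, b := b, b_pos := hb, βup := βup, em := w.em, ep := w.ep }, h', rfl, rfl, rfl, rfl, rfl, hγ',
    min_le_left _ _, fun h03 h05 h06 h07 h08 h09 h10 h11 h12 h13 => ?_⟩
  exact N24_at_record₈C h' le_rfl h03 h05 h06 h07 h08 h09 h10 h11 h12 h13 (fun k v hv => hlo k v (box_mono (min_le_right _ _) k hv))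
    fun k v hv => hhi k v (box_mono (min_le_right _ _) k hv)

end PerRecord

end Literature.MathematicalPhysics.QuantumFieldTheory.Balaban1983to89.Node00

end
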